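import Summits.NavierStokesRegularity.FluidComputer.PalasekTowerRegisterGlobalDesignExactHost
import Summits.NavierStokesRegularity.FluidComputer.PalasekTowerRegisterGlobalDesignSlot
import Summits.NavierStokesRegularity.FluidComputer.PalasekTowerHeredityWitnessUnconditional

/-!
# Host preparation, XI: the host of record has RISING RATE EXACTLY ZERO — the design slot `rising κ`, `κ > 0`, excludes it

Cell `ns-blowup`, seat `ns-blowup-ecbridge-3` (g2); GROUP C «BRIDGE SUPPORT» of the route
`PalasekTowerBreakdown` (crux `EpisodeBaseG`, item stmt-NavierStokesRegularity-19179). LABEL: E–C typing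
(KERNEL negative knowledge about the prescribed host of `PalasekTowerHost*.lean`, p418168 … p428335).
WHAT THIS IS NOT: not Navier–Stokes evidence — a statement about ONE designed flow's one-sided time
derivative at its readout; nothing about NS dynamics, `EpisodeBaseG = RungG 1` or blow-up.

The 19179 split shape of record (planner AMENDMENT STATUS l.2543; `HostClass.exact`, p424500) asks for a
NAMED design whose own flow GROWS to level `1`; the design slot of record for restricting hosts is
`(HostClass.nearC1 𝒰 ε₀ ε₁).inter (HostClass.rising κ)` (p419455): at every level-`0` floor point the
squared speed rises into `τ₀` at rate `≥ κ`. Every registered host rises at rate `≥ 0` by the global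
anchor (`HostClass.rising_zero`). This file shows that the host of record — seat ecbridge-3 g0's
prescribed two-component flow `Host.vel L L_b` on the schedule `Host.hostSchedule L L_b …` — rises at
rate EXACTLY `0`: its speed maximum `Y₀` is carried by a bump whose amplitude `a(t)` is constant from
`t = τ₀ = 1` on (`a'(1) = 0`), the bump's floor point is off the decaying slab packet, and by forced
weak–strong uniqueness (Sohr V.1.5.1, tree theorem; no W14) EVERY registered level-`0` stage of that
schedule has the velocity `Host.vel` on `[0, 1]`, hence one-sided time derivative `0` at the floor point.

* `Host.stage_u_eq_vel` — every level-`0` stage of `hostSchedule L L_b …` has velocity `vel L L_b` on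
  `[0, 1]`;
* `Host.timeDerivWithin_vel_floorPoint` — `∂ₜ⁻ vel (1, c + L_b x⋆) = 0`;
* `Host.rising_le_zero` / `Host.rising_iff` — a level-`0` stage of the host schedule lies in
  `HostClass.rising κ` iff `κ ≤ 0`;
* `Host.not_hostPreparationD_exact_inter_rising` — for `κ > 0` the class
  `(HostClass.exact (hostSchedule …)).inter (HostClass.rising κ)` is NOT prepared: the rising slot at any
  positive rate EXCLUDES the host family of record (so a `GoodHost` keyed on `rising κ`, `κ > 0`, is a
  genuine restriction of the register's level-`0` class, as the planner's R2 requires).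

References: S. Palasek, arXiv:2605.13827 §3.3–§4 [cite: Palasek2026ElementaryModel, §4]; H. Sohr,
*The Navier–Stokes Equations* (2001), Ch. V Thm. 1.5.1 [cite: Sohr2001, Ch. V Thm. 1.5.1].
-/

noncomputable section

namespace Summit.NavierStokesRegularity.FluidComputer.PalasekTowerClayBridge.Host

open Real Set Function Filter Topology InnerProductSpace Metric MeasureTheory
open scoped RealInnerProductSpace ContDiff Topology ENNReal

open Literature.Analysis.FluidPDE

variable {L Lb : ℝ}

/-- **Every registered level-`0` stage of the host schedule IS the host flow on `[0, 1]`**: forced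
weak–strong uniqueness against the prescribed classical finite-energy solution `vel L L_b`
(`Stage.velocity_eq_of_classical`, no W14). [cite: Sohr2001, Ch. V Thm. 1.5.1] -/
theorem stage_u_eq_vel (hL : 1 ≤ L) (hLb : 1 ≤ Lb)
    (hslab : ∀ x : EuclideanSpace ℝ (Fin 3), ‖slab L x‖ ≤ 11 / 10 * freq)
    {hpush : ∀ t ∈ Icc (1 : ℝ) τfirst, ∀ x : EuclideanSpace ℝ (Fin 3), ‖resid L Lb t x‖ ≤ 1 / 200 * TowerRates.wide.Y 0}
    (s₀ : Stage 1 TowerRates.wide (hostSchedule L Lb hL hLb hpush) (Margins.routeG TowerRates.wide) 0) :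
    ∀ t ∈ Icc (0 : ℝ) 1, s₀.u t = vel L Lb t := by
  have hL0 : 0 < L := by linarith
  have hLb0 : 0 < Lb := by linarith
  have hτ0 : (hostSchedule L Lb hL hLb hpush).τ 0 = 1 := hostSchedule_τ_zero hL hLb hpush
  have hcl : IsClassicalNSSolutionOn (Icc 0 (1 : ℝ)) 1 (hostSchedule L Lb hL hLb hpush).f (vel L Lb)
      (pres L) := isClassicalNSSolutionOn_vel hL0 hLb0
  have h := s₀.velocity_eq_of_classical one_pos (T' := 1) (le_of_eq hτ0) hcl
    (by rw [vel_zero]; rfl) (energy_vel hL0 hLb0 hslab)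
  rw [hτ0] at h
  exact fun t ht => (h t ht).symm

/-- **The host's one-sided time derivative VANISHES at the floor point at `t = 1`**: there the flow is
`a(t) • bump` (the point is off the slab packet) and `a'(1) = 0`. [folklore] -/
theorem timeDerivWithin_vel_floorPoint (hL : 1 ≤ L) (hLb : 1 ≤ Lb) :
    timeDerivWithin (Icc 0 1) (vel L Lb) 1 (center L Lb + Lb • thetaArgmax) = 0 := by
  have hL0 : 0 < L := by linarith
  have hLb0 : 0 < Lb := by linarith
  rw [timeDerivWithin_vel ⟨zero_le_one, le_rfl⟩, deriv_aProf_of_one_le le_rfl, zero_smul, zero_add,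
    slab_part_floorPoint hL0 hLb0, smul_zero]
where
  /-- the slab packet vanishes at the floor point -/
  slab_part_floorPoint (hL0 : 0 < L) (hLb0 : 0 < Lb) :
      slab L (center L Lb + Lb • thetaArgmax) = 0 :=
    (slab_zero hL0 (floorPoint_off_slab hL0.le hLb0)).1

/-- **RISING RATE EXACTLY ZERO**: if a registered level-`0` stage of the host schedule lies in the
design class `HostClass.rising κ`, then `κ ≤ 0` — at the floor point `c + L_b x⋆` (in the ball, speed
exactly `c₁ Y₀ = Y₀`) the pairing `⟪u, ∂ₜ⁻u⟫ (1, ·)` is `0`. [cite: Palasek2026ElementaryModel, §4] -/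
theorem rising_le_zero (hL : 1 ≤ L) (hLb : 1 ≤ Lb)
    (hslab : ∀ x : EuclideanSpace ℝ (Fin 3), ‖slab L x‖ ≤ 11 / 10 * freq)
    {hpush : ∀ t ∈ Icc (1 : ℝ) τfirst, ∀ x : EuclideanSpace ℝ (Fin 3), ‖resid L Lb t x‖ ≤ 1 / 200 * TowerRates.wide.Y 0}
    {κ : ℝ} (s₀ : Stage 1 TowerRates.wide (hostSchedule L Lb hL hLb hpush) (Margins.routeG TowerRates.wide) 0)
    (hs : HostClass.rising κ (hostSchedule L Lb hL hLb hpush) s₀) : κ ≤ 0 := by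
  have hL0 : 0 < L := by linarith
  have hLb0 : 0 < Lb := by linarith
  have hτ0 : (hostSchedule L Lb hL hLb hpush).τ 0 = 1 := hostSchedule_τ_zero hL hLb hpush
  set x₀ : EuclideanSpace ℝ (Fin 3) := center L Lb + Lb • thetaArgmax with hx₀
  have huv := stage_u_eq_vel hL hLb hslab s₀
  -- the floor point is in the ball and carries speed exactly `c₁ Y₀`
  have hball : ‖x₀‖ ≤ (hostSchedule L Lb hL hLb hpush).radius := by
    rw [hostSchedule_radius]; exact norm_floorPoint_le hL0.le hLb0
  have hfl : (hostSchedule L Lb hL hLb hpush).c₁ * TowerRates.wide.Y 0 ≤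
      ‖s₀.u ((hostSchedule L Lb hL hLb hpush).τ 0) x₀‖ := by
    rw [hostSchedule_c₁, one_mul, hτ0, huv 1 ⟨zero_le_one, le_rfl⟩, norm_vel_floorPoint hL0 hLb0]
  have hκ := hs x₀ hball hfl
  -- the one-sided time derivative of the stage at `(1, x₀)` is that of `vel`, i.e. `0`
  have hD : timeDerivWithin (Icc 0 ((hostSchedule L Lb hL hLb hpush).τ 0)) s₀.u
      ((hostSchedule L Lb hL hLb hpush).τ 0) x₀ = 0 := by
    rw [hτ0, timeDerivWithin_apply]
    have hcongr : derivWithin (fun s => s₀.u s x₀) (Icc 0 1) 1 =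
        derivWithin (fun s => vel L Lb s x₀) (Icc 0 1) 1 :=
      derivWithin_congr (fun s hs => by simp only [huv s hs]) (by simp only [huv 1 ⟨zero_le_one, le_rfl⟩])
    rw [hcongr, ← timeDerivWithin_apply, hx₀, timeDerivWithin_vel_floorPoint hL hLb]
  rw [hD, inner_zero_right] at hκ
  exact hκ

/-- **The host's membership in the rising classes, exactly**: a registered level-`0` stage of the host
schedule lies in `HostClass.rising κ` iff `κ ≤ 0` (`≥ 0` for every registered host by the anchor,
`HostClass.rising_zero`; `≤ 0` by `rising_le_zero`). [cite: Palasek2026ElementaryModel, §4] -/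
theorem rising_iff (hL : 1 ≤ L) (hLb : 1 ≤ Lb)
    (hslab : ∀ x : EuclideanSpace ℝ (Fin 3), ‖slab L x‖ ≤ 11 / 10 * freq)
    {hpush : ∀ t ∈ Icc (1 : ℝ) τfirst, ∀ x : EuclideanSpace ℝ (Fin 3), ‖resid L Lb t x‖ ≤ 1 / 200 * TowerRates.wide.Y 0}
    {κ : ℝ} (s₀ : Stage 1 TowerRates.wide (hostSchedule L Lb hL hLb hpush) (Margins.routeG TowerRates.wide) 0) :
    HostClass.rising κ (hostSchedule L Lb hL hLb hpush) s₀ ↔ κ ≤ 0 :=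
  ⟨rising_le_zero hL hLb hslab s₀,
    fun hκ => HostClass.rising_anti hκ _ _ (HostClass.rising_zero _ s₀)⟩

/-- **THE RISING SLOT AT ANY POSITIVE RATE EXCLUDES THE HOST FAMILY OF RECORD**: for `κ > 0` the
design class `(HostClass.exact (hostSchedule L L_b …)).inter (HostClass.rising κ)` is NOT prepared —
no pinned rigid quiet schedule carries a registered host in it (a host in it would have schedule
`= hostSchedule …` and rising rate `κ ≤ 0`). With `κ ≤ 0` it IS prepared
(`Host.hostPreparationD_exact`, p431242, and `HostClass.rising_zero`). So keying a `GoodHost` on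
`rising κ`, `κ > 0`, genuinely removes the cheapest inhabitant of the register's level-`0` class.
[cite: Palasek2026ElementaryModel, §4] -/
theorem not_hostPreparationD_exact_inter_rising (hL : 1 ≤ L) (hLb : 1 ≤ Lb)
    (hslab : ∀ x : EuclideanSpace ℝ (Fin 3), ‖slab L x‖ ≤ 11 / 10 * freq)
    {hpush : ∀ t ∈ Icc (1 : ℝ) τfirst, ∀ x : EuclideanSpace ℝ (Fin 3), ‖resid L Lb t x‖ ≤ 1 / 200 * TowerRates.wide.Y 0}
    {κ : ℝ} (hκ : 0 < κ) :
    ¬ HostPreparationD ((HostClass.exact (hostSchedule L Lb hL hLb hpush)).inter (HostClass.rising κ)) := by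
  rintro ⟨S, s₀, -, -, -, hS, hrise⟩
  have hS' : S = hostSchedule L Lb hL hLb hpush := hS
  subst hS'
  exact absurd (rising_le_zero hL hLb hslab s₀ hrise) (not_le.2 hκ)

/-- … while at rate `κ ≤ 0` the same class IS prepared by the host of record. [folklore] -/
theorem hostPreparationD_exact_inter_rising_of_nonpos (hL : 1 ≤ L) (hLb : 1 ≤ Lb)
    (hslab : ∀ x : EuclideanSpace ℝ (Fin 3), ‖slab L x‖ ≤ 11 / 10 * freq)
    (hpush : ∀ t ∈ Icc (1 : ℝ) τfirst, ∀ x : EuclideanSpace ℝ (Fin 3), ‖resid L Lb t x‖ ≤ 1 / 200 * TowerRates.wide.Y 0)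
    {κ : ℝ} (hκ : κ ≤ 0) :
    HostPreparationD ((HostClass.exact (hostSchedule L Lb hL hLb hpush)).inter (HostClass.rising κ)) := by
  obtain ⟨S, s₀, hP, hR, hQ, hS⟩ := hostPreparationD_exact hL hLb hslab hpush
  exact ⟨S, s₀, hP, hR, hQ, hS, HostClass.rising_anti hκ _ _ (HostClass.rising_zero _ s₀)⟩

end Summit.NavierStokesRegularity.FluidComputer.PalasekTowerClayBridge.Host

end
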